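import Summits.QuantumAdvantage.QuantumAdvantage.Theorems.CubicForrelationSignedExactCubicForrelationNotPrBPPGrowMachineClosure
import Summits.QuantumAdvantage.QuantumAdvantage.Theorems.CubicForrelationSignedExactCubicForrelationNotPrBPPStubMPairClosed
import Summits.QuantumAdvantage.QuantumAdvantage.Theorems.CubicForrelationSignedExactCubicForrelationNotPrBPPStubNoTrapTemplateLemmas2
import Literature.Computability.QuantumComplexity.MSubspaceSignReadoutSampler

/-!
# Crux `CubicForrelation.SignedExactCubicForrelationNotPrBPP` (stmt-QuantumAdvantage-13932), line `dual-pingpong-frame`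
# (GROW reshape): the GROW machine, IV — semantics of the bricks (third differences, spans, kernels, dual vectors)

Proof-only support file (`--supports stmt-QuantumAdvantage-13932`) toward the registered stub `stub_growFinder`: the
dictionary between the list bricks of `…GrowMachineBricks.lean` / `…GrowMachineClosure.lean` and the coordinate-free
vocabulary of the line (finsets of bit vectors, second differences). Throughout, the second difference
`D_u D_v g (x) = g x ⊕ g (x ⊕ u) ⊕ g (x ⊕ v) ⊕ g (x ⊕ u ⊕ v)` enters as a function parameter `D` with its defining
equation `hD` (as in `…StubNoTrapTemplateLemmas.lean`), the circuit code `cg` of `g` through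
`hg : evalP cg v = g (toInput n v)`, and inner products are spelled `(univ.filter fun i => uᵢ ∧ vᵢ).card.bodd`.

* Third differences `T(u, v, w) := D_u D_v g (0) ⊕ D_u D_v g (w)`: symmetric (no degree hypothesis), additive in each
  slot and base-point free for `g` of degree `≤ 3` (`NoTrap.D3_*`), represented by the row `k ↦ T(u, v, e_k)`; the
  cocycle laws of the offset `r ↦ D_s D_r g (0)`; the radical `rad B_s = {r : D_s D_r g const} = {r : T(s, r, ·) = 0}`.
* Bricks read in `{0,1}ⁿ`: `toInput (rowOf n cg s y) = row(s, y)`, `betaOf = D_s D_r g (0)`, `toInput (dualOf …)` is the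
  dual vector of the offset (`F2Elim.dotZ_dualVec_eq`), `dotL` / `orthChk` are inner products, `inSpan` is membership in
  the span finset `MMReadout.spanV`, `basisOf` keeps the span and has the rank as length, the span of `kerOf` is the
  kernel, and the candidate `candV` is the kernel parametrisation `MMReadout.kcV` of the candidate rows.
* Span induction (`spanV_induction`) and the unit vectors span everything (`mem_spanV_units`).

## References

* C. Carlet, *Boolean Functions for Cryptography and Coding Theory*, CUP 2021, §2.2.2, Prop. 54. [Carlet2020]
* D. E. Knuth, *TAOCP* Vol. 2, 3rd ed., §4.6.2 Algorithm N. [KnuthTAOCP2]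
* J. von zur Gathen, J. Gerhard, *Modern Computer Algebra*, 3rd ed., CUP 2013, §12.1. [VonzurgathenGerhard2013]
-/

noncomputable section

set_option linter.dupNamespace false -- D-0017: single-problem summit ⇒ `QuantumAdvantage.QuantumAdvantage` by design

namespace Summit.QuantumAdvantage.QuantumAdvantage.Theorems.SignedExactCubicForrelationNotPrBPP.GrowMachine

open Finset
open Literature.Computability.Complexity Literature.Computability.QuantumComplexity
open Literature.Computability.Complexity.F2Elim
open Literature.Computability.Complexity.BLR (toZ toZ_xor toZ_and toZ_injective)
open Literature.Computability.QuantumComplexity.BuzetChailloux (bxor zeroVec bxor_self bxor_comm bxor_zeroVec zeroVec_bxor)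
open PolarGeometry (toZ_bdot bdot_comm bdot_bxor_left bdot_bxor_right bxor_bxor_swap bxor_bxor_assoc)
open NoTrap (bdot_zeroVec bdot_unit D_symm D_bxor_left D_zeroVec_eq D3_swap D3_basefree D3_bxor D3_repr)
open ForrCode QuadSampler MMReadout
open FinderMachine (Vec Mat normV basisOf kerOf inSpan)

variable {n : ℕ}

/-! ### Inner products and `𝔽₂`-readings -/

/-- The inner product read in `𝔽₂` is `dotZ` of the `𝔽₂`-readings. [folklore] -/
theorem toZ_bd (u v : Fin n → Bool) : toZ (univ.filter fun i => u i && v i).card.bodd = dotZ (bz u) (bz v) := by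
  rw [toZ_bdot, dotZ]
  exact sum_congr rfl fun i _ => by rw [bz_apply, bz_apply, toZ_and]

/-- `zb (vecZ n r) = toInput n r`. [folklore] -/
theorem zb_vecZ (r : List Bool) : zb (vecZ n r) = toInput n r := by rw [vecZ_eq_bz, zb_bz]

/-- **The machine's dot product is the inner product.** [folklore] -/
theorem dotL_eq_bd (u v : List Bool) :
    dotL n u v = (univ.filter fun i => toInput n u i && toInput n v i).card.bodd := by
  apply toZ_injective; rw [toZ_dotL, toZ_bd]; rfl

/-- `r · d = 0` in `𝔽₂` iff the inner product bit vanishes. [folklore] -/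
theorem dotZ_bz_eq_zero_iff (u v : Fin n → Bool) :
    dotZ (bz u) (bz v) = 0 ↔ (univ.filter fun i => u i && v i).card.bodd = false := by
  rw [← toZ_bd, toZ_eq_zero_iff]

/-- Kernel membership is orthogonality to every row. [folklore] -/
theorem bz_mem_kerSet_iff (M : List (List Bool)) (v : Fin n → Bool) :
    bz v ∈ kerSet n M ↔ ∀ r ∈ M, (univ.filter fun i => toInput n r i && v i).card.bodd = false := by
  refine forall₂_congr fun r _ => ?_
  rw [vecZ_eq_bz, dotZ_bz_eq_zero_iff]

/-- The kernel of a concatenation. [folklore] -/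
theorem mem_kerSet_append {A B : List (List Bool)} {d : Fin n → ZMod 2} :
    d ∈ kerSet n (A ++ B) ↔ d ∈ kerSet n A ∧ d ∈ kerSet n B := by
  simp only [kerSet, Set.mem_setOf_eq, List.mem_append]
  exact ⟨fun h => ⟨fun r hr => h r (Or.inl hr), fun r hr => h r (Or.inr hr)⟩, fun h r hr => hr.elim (h.1 r) (h.2 r)⟩

/-- A vector vanishing on every unit vector is zero. [folklore] -/
theorem eq_zeroVec_of_bd_unit {w : Fin n → Bool}
    (h : ∀ k : Fin n, (univ.filter fun i => w i && (fun j => decide (j = k)) i).card.bodd = false) : w = zeroVec := by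
  funext k
  have hk := h k
  rw [bdot_comm, bdot_unit] at hk
  exact hk

/-! ### Third differences of a cubic: the symmetric trilinear form `T(u,v,w) = D_u D_v g (0) ⊕ D_u D_v g (w)` -/

section ThirdDiff

variable {g : (Fin n → Bool) → Bool} (D : (Fin n → Bool) → (Fin n → Bool) → (Fin n → Bool) → Bool)
  (hD : ∀ u v x, D u v x = (g x ^^ g (bxor x u) ^^ g (bxor x v) ^^ g (bxor x (bxor u v))))
include hD

/-- `D_0 D_v g = 0`. [folklore] -/
theorem D_zero_left (v x : Fin n → Bool) : D zeroVec v x = false := by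
  rw [hD, bxor_zeroVec, show bxor zeroVec v = v from zeroVec_bxor v]
  cases g x <;> cases g (bxor x v) <;> rfl

/-- `D_u D_0 g = 0`. [folklore] -/
theorem D_zero_right (u x : Fin n → Bool) : D u zeroVec x = false := by
  rw [D_symm D hD]; exact D_zero_left D hD u x

/-- `T(u, v, w) = T(v, u, w)`. [folklore] -/
theorem T_symm12 (u v w : Fin n → Bool) : (D u v zeroVec ^^ D u v w) = (D v u zeroVec ^^ D v u w) := by
  rw [D_symm D hD u v, D_symm D hD u v]

/-- `T(u, v, w) = T(u, w, v)`. [folklore] -/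
theorem T_symm23 (u v w : Fin n → Bool) : (D u v zeroVec ^^ D u v w) = (D u w zeroVec ^^ D u w v) := D3_swap D hD u v w

/-- `T(0, v, w) = 0`. [folklore] -/
theorem T_zero_left (v w : Fin n → Bool) : (D zeroVec v zeroVec ^^ D zeroVec v w) = false := by
  rw [D_zero_left D hD, D_zero_left D hD]; rfl

/-- The cocycle law of the offset in `r`: `D_s D_{r ⊕ r'} g (0) = D_s D_r g (0) ⊕ D_s D_{r'} g (0) ⊕ T(s, r, r')`.
[cite: Carlet2020, §2.2.2] -/
theorem D0_bxor_right (s r r' : Fin n → Bool) :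
    D s (bxor r r') zeroVec = (D s r zeroVec ^^ D s r' zeroVec ^^ (D s r zeroVec ^^ D s r r')) := by
  rw [D_symm D hD s (bxor r r'), D_bxor_left D hD r r' s zeroVec, zeroVec_bxor, D_symm D hD r s, D_symm D hD r' s]
  cases D s r r' <;> cases D s r' zeroVec <;> cases D s r zeroVec <;> rfl

/-- The cocycle law of the offset in `s`: `D_{s ⊕ s'} D_r g (0) = D_s D_r g (0) ⊕ D_{s'} D_r g (0) ⊕ T(s, r, s')`.
[cite: Carlet2020, §2.2.2] -/
theorem D0_bxor_left (s s' r : Fin n → Bool) :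
    D (bxor s s') r zeroVec = (D s r zeroVec ^^ D s' r zeroVec ^^ (D s r zeroVec ^^ D s r s')) := by
  rw [D_bxor_left D hD s s' r zeroVec, zeroVec_bxor]
  cases D s r s' <;> cases D s' r zeroVec <;> cases D s r zeroVec <;> rfl

omit hD in
/-- Every base point: `D_u D_v g (x) = D_u D_v g (0) ⊕ T(u, v, x)`. [folklore] -/
theorem D_eq_D0_xor_T (u v x : Fin n → Bool) : D u v x = (D u v zeroVec ^^ (D u v zeroVec ^^ D u v x)) := by
  cases D u v zeroVec <;> cases D u v x <;> rfl

variable (hg3 : IsDegLeFun 3 g)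
include hg3

/-- Additivity in the third slot (degree `≤ 3`). [cite: Carlet2020, §2.2.2] -/
theorem T_bxor3 (u v w w' : Fin n → Bool) :
    (D u v zeroVec ^^ D u v (bxor w w')) = ((D u v zeroVec ^^ D u v w) ^^ (D u v zeroVec ^^ D u v w')) := D3_bxor hg3 D hD u v w w'

/-- Additivity in the second slot (degree `≤ 3`). [cite: Carlet2020, §2.2.2] -/
theorem T_bxor2 (u v v' w : Fin n → Bool) :
    (D u (bxor v v') zeroVec ^^ D u (bxor v v') w) = ((D u v zeroVec ^^ D u v w) ^^ (D u v' zeroVec ^^ D u v' w)) := by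
  rw [T_symm23 D hD u (bxor v v') w, T_bxor3 D hD hg3 u w v v', T_symm23 D hD u w v, T_symm23 D hD u w v']

/-- Additivity in the first slot (degree `≤ 3`). [cite: Carlet2020, §2.2.2] -/
theorem T_bxor1 (u u' v w : Fin n → Bool) :
    (D (bxor u u') v zeroVec ^^ D (bxor u u') v w) = ((D u v zeroVec ^^ D u v w) ^^ (D u' v zeroVec ^^ D u' v w)) := by
  rw [T_symm12 D hD (bxor u u') v w, T_bxor2 D hD hg3 v u u' w, T_symm12 D hD v u w, T_symm12 D hD v u' w]

/-- **Row representation** (degree `≤ 3`): `T(u, v, w) = row(u, v) · w` with `row(u, v)_k = T(u, v, e_k)`.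
[cite: Carlet2020, §2.2.2] -/
theorem T_eq_bd_row (u v w : Fin n → Bool) :
    (D u v zeroVec ^^ D u v w) = (univ.filter fun i => (fun k => (D u v zeroVec ^^ D u v (fun j => decide (j = k)))) i && w i).card.bodd :=
  D3_repr hg3 D hD u v w

/-- **The radical**: `D_s D_r g` is constant iff `T(s, r, ·) = 0` (degree `≤ 3`). [cite: Carlet2020, §2.2.2] -/
theorem inRad_iff (s r : Fin n → Bool) :
    (∀ y z : Fin n → Bool, (D s r z ^^ D s r (bxor z y)) = false) ↔ ∀ y, (D s r zeroVec ^^ D s r y) = false := by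
  constructor
  · intro h y; have := h y zeroVec; rwa [zeroVec_bxor] at this
  · intro h y z; rw [D3_basefree hg3 D hD s r y z]; exact h y

/-- `T(s, r, ·) = 0` iff it vanishes on the unit vectors (degree `≤ 3`). [cite: Carlet2020, §2.2.2] -/
theorem T_eq_false_iff_units (s r : Fin n → Bool) :
    (∀ y, (D s r zeroVec ^^ D s r y) = false) ↔ ∀ k : Fin n, (D s r zeroVec ^^ D s r (fun j => decide (j = k))) = false := by
  refine ⟨fun h k => h _, fun h y => ?_⟩
  rw [T_eq_bd_row D hD hg3 s r y]
  have hz : (fun k => (D s r zeroVec ^^ D s r (fun j => decide (j = k)))) = (zeroVec : Fin n → Bool) := funext fun k => h k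
  rw [hz, bdot_comm]
  exact bdot_zeroVec y

end ThirdDiff

/-! ### The bricks read in `{0,1}ⁿ` -/

/-- The rows of a slice. [folklore] -/
theorem mem_sliceOf_iff {cg : PCirc} {s r : List Bool} : r ∈ sliceOf n cg s ↔ ∃ i : Fin n, r = rowOf n cg s (unitL n i) := by
  simp only [sliceOf, List.mem_map, List.mem_range]
  exact ⟨fun ⟨i, hi, h⟩ => ⟨⟨i, hi⟩, h.symm⟩, fun ⟨i, h⟩ => ⟨i, i.isLt, h.symm⟩⟩

/-- The rows of the stacked slices. [folklore] -/
theorem mem_stackOf_iff {cg : PCirc} {S : Mat} {r : List Bool} : r ∈ stackOf n cg S ↔ ∃ s ∈ S, ∃ i : Fin n, r = rowOf n cg s (unitL n i) := by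
  simp only [stackOf, List.mem_flatten, List.mem_map]
  constructor
  · rintro ⟨B, ⟨s, hs, rfl⟩, hr⟩; exact ⟨s, hs, mem_sliceOf_iff.1 hr⟩
  · rintro ⟨s, hs, h⟩; exact ⟨_, ⟨s, hs, rfl⟩, mem_sliceOf_iff.2 h⟩

section Bricks

variable {g : (Fin n → Bool) → Bool} (D : (Fin n → Bool) → (Fin n → Bool) → (Fin n → Bool) → Bool)
  (hD : ∀ u v x, D u v x = (g x ^^ g (bxor x u) ^^ g (bxor x v) ^^ g (bxor x (bxor u v))))
  {cg : PCirc} (hg : ∀ v, evalP cg v = g (toInput n v))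
include hD hg

/-- The machine's second difference is `D`. [folklore] -/
theorem d2_eq_D (y r s : List Bool) : d2 cg y r s = D (toInput n r) (toInput n s) (toInput n y) := by
  rw [d2, hg, hg, hg, hg, toInput_bxorL, toInput_bxorL, toInput_bxorL, toInput_bxorL, hD]; rfl

/-- **The slice row read in `{0,1}ⁿ`** is the row `k ↦ T(s, y, e_k)` of the line's closedness clause. [cite: Carlet2020, §2.2.2] -/
theorem toInput_rowOf (s y : List Bool) :
    toInput n (rowOf n cg s y) = fun k => (D (toInput n s) (toInput n y) zeroVec ^^ D (toInput n s) (toInput n y) (fun j => decide (j = k))) := by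
  rw [rowOf, toInput_map_range]
  funext k
  rw [d2_eq_D D hD hg, d2_eq_D D hD hg, toInput_zeroL, toInput_unitL]; rfl

/-- **The offset functional is `D_s D_r g (0)`.** [cite: Carlet2020, §2.2.2] -/
theorem betaOf_eq (s r : List Bool) : betaOf n cg s r = D (toInput n s) (toInput n r) zeroVec := by
  rw [betaOf, hg, hg, hg, hg, toInput_bxorL, toInput_zeroL, D_zeroVec_eq D hD]; rfl

/-- **The dual vector read in `𝔽₂`**: the dual vector of `r ↦ D_s D_r g (0)` with respect to the swept state `R`
(cf. `F2Elim.dotZ_dualVec_eq`). [cite: VonzurgathenGerhard2013, §12.1] -/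
theorem bz_toInput_dualOf (s : List Bool) (R : List Row) :
    bz (toInput n (dualOf n cg s R)) = fun c : Fin n => if isPiv R c = true then toZ (D (toInput n s) (zb (vecZ n (prow R c))) zeroVec) else 0 := by
  funext c
  rw [dualOf, toInput_map_range, bz_apply]
  by_cases hp : isPiv R c = true
  · rw [hp, Bool.true_and, if_pos rfl, betaOf_eq D hD hg, zb_vecZ]
  · rw [Bool.not_eq_true] at hp
    rw [hp, Bool.false_and, if_neg Bool.false_ne_true]; rfl

/-- **Kernel of the stacked slices** (degree `≤ 3`): `v` is orthogonal to every slice row of `S` iff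
`T(s, v, ·) = 0` for every row `s` of `S` (`v ∈ ⋂ rad B_s`). [cite: Carlet2020, §2.2.2] -/
theorem bz_mem_kerSet_stackOf_iff (hg3 : IsDegLeFun 3 g) (S : Mat) (v : Fin n → Bool) :
    bz v ∈ kerSet n (stackOf n cg S) ↔ ∀ s ∈ S, ∀ y, (D (toInput n s) v zeroVec ^^ D (toInput n s) v y) = false := by
  rw [bz_mem_kerSet_iff]
  constructor
  · intro h s hs
    rw [T_eq_false_iff_units D hD hg3]
    intro k
    have hk := h _ (mem_stackOf_iff.2 ⟨s, hs, k, rfl⟩)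
    rw [toInput_rowOf D hD hg, toInput_unitL, ← T_eq_bd_row D hD hg3] at hk
    rw [T_symm23 D hD]; exact hk
  · intro h r hr
    obtain ⟨s, hs, k, rfl⟩ := mem_stackOf_iff.1 hr
    rw [toInput_rowOf D hD hg, toInput_unitL, ← T_eq_bd_row D hD hg3, T_symm23 D hD]
    exact h s hs _

end Bricks

/-- **The machine's dot product is the inner product** (registered brick `grow_dotLEqBd` of stub `stub_growFinder`, line
`dual-pingpong-frame`, crux stmt-QuantumAdvantage-13932). [folklore] -/
theorem grow_dotLEqBd : ∀ {n : ℕ} (u v : List Bool), MMReadout.dotL n u v = ((Finset.univ.filter fun i => ForrCode.toInput n u i && ForrCode.toInput n v i).card).bodd :=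
  fun u v => dotL_eq_bd u v

end Summit.QuantumAdvantage.QuantumAdvantage.Theorems.SignedExactCubicForrelationNotPrBPP.GrowMachine

end
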